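import Summits.AnomalousDissipation.AnomalousDissipation.Theses.SawtoothPulseCascade

/-!
# `SawtoothPulseCascade.K3LocalisedClosureGlue` (stmt-AnomalousDissipation-19690) — the glue of the
K3loc split

Route `AnomalousDissipation/SawtoothPulseCascade`, rev 11/12 (2026-08-26): the crux `K3LocalisedClosure`
(stmt-AnomalousDissipation-19492, `K1LocalisedCascade → K2LinearisedCascadeGrowth → Target`) was split along the
lead prover's registered line `Cruxes.K3LocalisedClosure.DriftFree` (skeleton v3.2, sha `ced323057a45`) into
`Packaging58 → ApproxSol58 → DriftFreeClosure58 → K3LocalisedClosure`.  This file proves the glue item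
`K3LocalisedClosureGlue` — the body of the kernel-checked composition `K3LocalisedClosure_of` of that skeleton,
transcribed over the three children:

* unpack `ConstructionRegular` (first conjunct of `Packaging58`) at the box point `(γ, ρN) = (5, 2)` — smooth
  lifted datum, force jointly smooth on `[0, 1)`, Hölder-bounded / Hölder-continuous up to `t = 1`;
* feed `K2LinearisedCascadeGrowth` to `ApproxSol58` (approximate solutions at rate `γ² − 3` on the box) and
  `K1LocalisedCascade`, `Existence` (second conjunct of `Packaging58`) and the approximate solutions to
  `DriftFreeClosure58`, obtaining the planar anomalous family `DriftFree.PlanarAnomalousFamily ⟨5, ¼, 2, 1, 2⟩`: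
  viscosities `ν_m ↓ 0`, planar velocities `V m`, pressures `φ m`, transported scalars `R m`, anomalous
  dissipation of the lifts;
* the `Target` (= Brué–De Lellis Question 2.1, rung F-D1.BDL) is witnessed by the 2½-D lifts
  `Torus.twoHalf (V m t) (R m t)` with pressure `φ m t ∘ Torus.planarProj`, datum `DriftFree.liftedDatum` and
  force `DriftFree.liftedForce ⟨5, ¼, 2, 1, 2⟩`; the lift is a classical Navier–Stokes solution on `[0, 1)` by
  the tree theorem `DriftFree.liftClassical`, and its initial value is the lifted datum by rewriting
  `V m 0 = 0`, `R m 0 = sin 2πx₁`.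

Fifteen lines of logic, no analysis (all analysis lives in the children).
-/

-- `Summit.<Summit>.<Problem>` is the tree's mandated summit-side namespace (CONVENTIONS §2); for this
-- single-conjunct summit the two coincide, so the duplicate is deliberate (lakefile: off for `Summits`).
set_option linter.dupNamespace false

namespace Summit.AnomalousDissipation.AnomalousDissipation.Theorems.SawtoothPulseCascade

open Summit.AnomalousDissipation.AnomalousDissipation.Theses.SawtoothPulseCascade in
/-- Proves the glue item `K3LocalisedClosureGlue` (stmt-AnomalousDissipation-19690):
`Packaging58 → ApproxSol58 → DriftFreeClosure58 → K3LocalisedClosure` — the 2½-D lift of the planar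
anomalous family at the box point `(γ, ρN) = (5, 2)` (composition `K3LocalisedClosure_of` of the registered
DriftFree skeleton v3.2). -/
theorem k3LocalisedClosureGlue_proof :
    Summit.AnomalousDissipation.AnomalousDissipation.Theses.SawtoothPulseCascade.K3LocalisedClosureGlue := by
  intro hP hA hD hK1 hK2
  have hreg := hP.1
  have hex := hP.2
  have happ := hA hK2
  have hfam := hD hK1 hex happ
  have h5 : (5 : ℝ) ∈ Set.Icc (5 : ℝ) 8 := ⟨le_rfl, by norm_num⟩
  have h2' : (2 : ℕ) ∈ Finset.Icc 2 7 := by simp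
  obtain ⟨hdat, hfs, hhold⟩ := hreg 5 h5 2 h2'
  obtain ⟨ν, hν, V, φ, R, hm, hAD⟩ := hfam 5 h5 2 h2'
  refine ⟨ν, Literature.Analysis.FluidPDE.SawtoothCascade.DriftFree.liftedDatum,
    Literature.Analysis.FluidPDE.SawtoothCascade.DriftFree.liftedForce ⟨5, 1 / 4, 2, 1, 2⟩,
    fun m t => Literature.Analysis.FunctionSpaces.Torus.twoHalf (V m t) (R m t),
    fun m t => φ m t ∘ Literature.Analysis.FunctionSpaces.Torus.planarProj, hν, hdat, hhold, hfs,
    fun m => ⟨?_, ?_, (hm m).2.2.2.2⟩, hAD⟩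
  · exact Literature.Analysis.FluidPDE.SawtoothCascade.DriftFree.liftClassical _ _ _ _ _ (hm m).1 (hm m).2.2.1
  · show Literature.Analysis.FunctionSpaces.Torus.twoHalf (V m 0) (R m 0) =
        Literature.Analysis.FluidPDE.SawtoothCascade.DriftFree.liftedDatum
    rw [(hm m).2.1, (hm m).2.2.2.1]
    rfl

end Summit.AnomalousDissipation.AnomalousDissipation.Theorems.SawtoothPulseCascade
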